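import Literature.AlgebraicGeometry.ComplexMultiplication.EndomorphismFieldLieAlgebraDeterminesType
import Literature.NumberTheory.ComplexMultiplication.CMStructureUniformized
import Literature.NumberTheory.ComplexMultiplication.ShimuraTaniyamaHecke
import Mathlib.FieldTheory.PrimitiveElement
import HarnessLib

/-!
# Two CM pairs with the same characteristic polynomial of `ι(a)` on `Lie` (or on the cotangent space) have the same type

Topic `Literature/AlgebraicGeometry/ComplexMultiplication` (the ALGEBRAIC carrier `Motives.AbelianVariety ℂ`; Shimura's pairs
`(A, ι : F → End⁰ A)` with `[F : ℚ] = 2 dim A` and THE type `cmTypeOfPair`), namespace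
`Literature.AlgebraicGeometry.ComplexMultiplication`.  THEOREMS ONLY (no definition, no named fact; net debt 0).  Sequel of
`EndomorphismFieldLieAlgebraSignature` («every `x` acts on `Lie(A)` with characteristic polynomial `∏_{φ ∈ Φ}(T − φ(x))`») and
`EndomorphismFieldLieAlgebraDeterminesType` (ONE characteristic polynomial at a primitive element determines `Φ`).

THE PRINT.  B. Howard [Howard2012] §3.1, display after Def. 3.1.1 (held text `paper:arxiv-1303.0545` p. 19): «this condition
implies that every `x ∈ 𝒪_K` acts on `Lie(A)` with characteristic polynomial `∏_{φ ∈ Φ} (T − φ(x))`»; G. Shimura [Shimura1998]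
§5.2 pp. 36–39 («the set `{φ₁, …, φₙ}` being thus determined, we say that `(A, ι)` is of type `(F; {φ₁, …, φₙ})`», the
`ωᵢ` with `δι(α)ωᵢ = α^{φᵢ}ωᵢ`) and §12.4 Prop. 26, proof p. 109 (specialisation of a structure `(A, ι)` preserves its type —
the step this file isolates: the type of the specialised structure is read off ONE characteristic polynomial, which a
specialisation over a `ℚ̄`-algebra does not change).

WHAT IS PROVED.
* §1 `cmTypeOfPair_eq_of_charpoly_lieAction_eq`: two pairs `(A, ι_A)`, `(B, ι_B)` under the same field `F` (full degree
  for both) with `char(ι_B(a) | Lie B) = char(ι_A(a) | Lie A)` at ONE primitive element `a` of `F/ℚ` have the same type;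
  `…_of_forall_charpoly_lieAction_eq` (all `a`); `…_of_forall_charpoly_cotangentMap_eq` (cotangent form at the integers `𝓞_F`,
  the shape in which a model over a ring delivers it).
* §2 `exists_isCMTypeRealisation_of_forall_charpoly_cotangentMap_eq`: realisation form on `H¹` (the tree's
  `IsCMTypeRealisation`): if `(A, ι, θ)` realises `(K; Φ)` and a principal structure `(B, κ)` of full degree has the same
  cotangent characteristic polynomials `char(κ(a)^* | 𝔪_e/𝔪_e²)`, `a ∈ 𝓞_K`, then `(B, κ, θ')` realises `(K; Φ)` for the `θ'`
  of its rational endomorphism action — the hypothesis shape of step (S4) of the `_holds` programme for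
  `shimura1998_prop26_definedOverQbar` (cell `hodgecm-mathlib`, plan `PREP-II2beta-Prop26Qbar.md`), whose (S4a) supplies the
  equality of characteristic polynomials from ONE polynomial over the base of a model
  (`RingTheory/Smooth/AugmentationIdealCotangentBaseChange`).
* §0 plumbing: an INTEGRAL primitive element (`exists_ringOfIntegers_adjoin_eq_top`).

## References
* [Howard2012] B. Howard, *Complex multiplication cycles and Kudla–Rapoport divisors*, Ann. of Math. 176 (2012), §3.1.
* [Shimura1998] G. Shimura, *Abelian Varieties with Complex Multiplication and Modular Functions* (1998), §5.2 pp. 36–39;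
  §12.4 Prop. 26 and proof p. 109.
* [Kottwitz1992] R. E. Kottwitz, J. Amer. Math. Soc. 5 (1992), §5, p. 390.
-/

noncomputable section

namespace Literature.AlgebraicGeometry.ComplexMultiplication

open scoped Polynomial IntermediateField
open CategoryTheory NumberField Module Polynomial
open Literature.AlgebraicGeometry.Motives
open Literature.AlgebraicGeometry.HodgeTheory
open Literature.NumberTheory.ComplexMultiplication

/-! ### §0 An integral primitive element -/

/-- **A number field has a primitive element which is an algebraic INTEGER**: `K = ℚ(a)` with `a ∈ 𝓞_K` (a primitive
element times a suitable non-zero integer is integral and still primitive). [folklore] -/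
private theorem exists_ringOfIntegers_adjoin_eq_top (K : Type) [Field K] [NumberField K] :
    ∃ a : 𝓞 K, ℚ⟮((a : K))⟯ = ⊤ := by
  obtain ⟨z, hz⟩ := Field.exists_primitive_element ℚ K
  obtain ⟨y, hy, hint⟩ := exists_integral_multiples ℤ ℚ ({z} : Finset K)
  have hyz : IsIntegral ℤ (y • z) := hint z (Finset.mem_singleton_self z)
  refine ⟨⟨y • z, hyz⟩, ?_⟩
  rw [eq_top_iff, ← hz, IntermediateField.adjoin_simple_le_iff]
  have hmem : (y : ℚ)⁻¹ • (y • z) ∈ ℚ⟮((⟨y • z, hyz⟩ : 𝓞 K) : K)⟯ :=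
    IntermediateField.smul_mem _ (IntermediateField.mem_adjoin_simple_self ℚ _)
  have e : (y : ℚ)⁻¹ • (y • z) = z := by
    rw [← Int.cast_smul_eq_zsmul ℚ y z, inv_smul_smul₀ (Int.cast_ne_zero.2 hy)]
  rwa [e] at hmem

/-! ### §1 Pairs: equal `char(ι(a) | Lie)` at a primitive `a` ⟹ equal types -/

section Pairs

variable {F : Type} [Field F] [NumberField F] {A B : AbelianVariety ℂ}
  (ιA : F →+* A.endAlgebra) (hA : finrank ℚ F = 2 * A.dim) (ιB : F →+* B.endAlgebra) (hB : finrank ℚ F = 2 * B.dim)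

/-- **Two pairs `(A, ι_A)`, `(B, ι_B)` under `F` (of full degree) with `char(ι_B(a) | Lie B) = char(ι_A(a) | Lie A)` at ONE
primitive element `a` of `F/ℚ` have the same type** — `char(ι_A(a) | Lie A) = ∏_{φ ∈ Φ_A}(X − φ(a))` (Howard's display) and
one such polynomial at a primitive element determines the type (`coe_eq_cmTypeOfPair_of_charpoly_lieAction_eq_prod`).
[cite: Howard2012, §3.1 (display after Def. 3.1.1)] [cite: Shimura1998, §5.2 (pp. 36–39)] -/
theorem cmTypeOfPair_eq_of_charpoly_lieAction_eq {a : F} (ha : ℚ⟮a⟯ = ⊤)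
    (h : (Motives.AbelianVariety.lieAction B (ιB a)).charpoly = (Motives.AbelianVariety.lieAction A (ιA a)).charpoly) :
    cmTypeOfPair ιB hB = cmTypeOfPair ιA hA := by
  classical
  set Ψ : Finset (F →+* ℂ) := (cmTypeOfPair ιA hA).1.toFinset with hΨ
  have hΨA : (Motives.AbelianVariety.lieAction A (ιA a)).charpoly = ∏ ψ ∈ Ψ, (X - C (ψ a : ℂ)) :=
    (EndFieldFullDegree.charpoly_lieAction_eq_prod_iff ιA hA ha Ψ).2 (Set.coe_toFinset _)
  have hΨB : (Ψ : Set (F →+* ℂ)) = (cmTypeOfPair ιB hB).1 :=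
    (EndFieldFullDegree.charpoly_lieAction_eq_prod_iff ιB hB ha Ψ).1 (h.trans hΨA)
  refine Subtype.ext ?_
  rw [← hΨB, hΨ, Set.coe_toFinset]

/-- **… and so do two pairs with `char(ι_B(a) | Lie B) = char(ι_A(a) | Lie A)` for every `a ∈ F`** (a primitive element
exists). [cite: Howard2012, §3.1 (display after Def. 3.1.1)] [cite: Shimura1998, §5.2 (pp. 36–39)] -/
theorem cmTypeOfPair_eq_of_forall_charpoly_lieAction_eq
    (h : ∀ a : F, (Motives.AbelianVariety.lieAction B (ιB a)).charpoly =
      (Motives.AbelianVariety.lieAction A (ιA a)).charpoly) :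
    cmTypeOfPair ιB hB = cmTypeOfPair ιA hA := by
  obtain ⟨a, ha⟩ := Field.exists_primitive_element ℚ F
  exact cmTypeOfPair_eq_of_charpoly_lieAction_eq ιA hA ιB hB ha (h a)

/-- **Cotangent form at the integers**: if `ι_A(a) = 1 ⊗ u_a`, `ι_B(a) = 1 ⊗ v_a` for genuine endomorphisms `u_a ∈ End A`,
`v_a ∈ End B` attached to every `a ∈ 𝓞_F`, and `char(v_a^* | 𝔪_e/𝔪_e²(B)) = char(u_a^* | 𝔪_e/𝔪_e²(A))` for all `a ∈ 𝓞_F`,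
then the two pairs have the same type (Lie algebra = dual of the cotangent space; an integral primitive element).
[cite: Shimura1998, §5.2 (pp. 36–39) and §3.2] [cite: Howard2012, §3.1 (display after Def. 3.1.1)] -/
theorem cmTypeOfPair_eq_of_forall_charpoly_cotangentMap_eq (u : 𝓞 F → End A) (v : 𝓞 F → End B)
    (hu : ∀ a : 𝓞 F, AbelianVariety.endAlgebra.of A (u a) = ιA (a : F))
    (hv : ∀ a : 𝓞 F, AbelianVariety.endAlgebra.of B (v a) = ιB (a : F))
    (h : ∀ a : 𝓞 F, (Motives.AbelianVariety.cotangentMap B (v a)).charpoly =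
      (Motives.AbelianVariety.cotangentMap A (u a)).charpoly) :
    cmTypeOfPair ιB hB = cmTypeOfPair ιA hA := by
  obtain ⟨a, ha⟩ := exists_ringOfIntegers_adjoin_eq_top F
  refine cmTypeOfPair_eq_of_charpoly_lieAction_eq ιA hA ιB hB ha ?_
  rw [← EndFieldFullDegree.charpoly_cotangentMap_eq_charpoly_lieAction ιB (hv a),
    ← EndFieldFullDegree.charpoly_cotangentMap_eq_charpoly_lieAction ιA (hu a), h a]

end Pairs

/-! ### §2 Realisations on `H¹`: the type survives equal cotangent characteristic polynomials -/

section Realisation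

variable {K : Type} [Field K] [NumberField K] (Φ : CMType K) {A B : AbelianVariety ℂ} {ι : 𝓞 K →+* End A}
  {θ : K →+* Module.End ℂ (complexBetti A.X 1)} (κ : 𝓞 K →+* End B)

/-- **Transfer of the type through equal cotangent characteristic polynomials.**  If `(A, ι, θ)` realises `(K; Φ)` on `H¹`
(`IsCMTypeRealisation`) and `(B, κ)` is a principal `𝓞_K`-structure of full degree `[K : ℚ] = 2 dim B` whose cotangent
characteristic polynomials agree with those of `(A, ι)` — `char(κ(a)^* | 𝔪_e/𝔪_e²(B)) = char(ι(a)^* | 𝔪_e/𝔪_e²(A))` for every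
`a ∈ 𝓞_K` — then `(B, κ, θ')` realises `(K; Φ)`, with `θ'` the complexified rational action of `κ` (the tree's
`complexAction`).  This is the form of Shimura's «the specialised structure is again of type `(F; {φᵢ})`» (proof of Prop. 26,
p. 109) that a model over a `ℚ̄`-algebra delivers: the characteristic polynomial of `ι(a)` on the conormal module of the unit
section is ONE polynomial over the base, read in every fibre.
[cite: Shimura1998, §12.4 Prop. 26 (proof, p. 109) and §5.2 (pp. 36–39)] [cite: Howard2012, §3.1 (display after Def. 3.1.1)] -/
theorem exists_isCMTypeRealisation_of_forall_charpoly_cotangentMap_eq (hA : IsCMTypeRealisation Φ A ι θ)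
    (hB : finrank ℚ K = 2 * B.dim)
    (h : ∀ a : 𝓞 K, (Motives.AbelianVariety.cotangentMap B (κ a)).charpoly =
      (Motives.AbelianVariety.cotangentMap A (ι a)).charpoly) :
    ∃ θ' : K →+* Module.End ℂ (complexBetti B.X 1), IsCMTypeRealisation Φ B κ θ' := by
  -- the rational actions `φ_A : K → End⁰ A`, `φ_B : K → End⁰ B` extending `ι`, `κ`
  obtain ⟨φA, hφA⟩ := exists_ringHom_endAlgebra (A₀ := A) ι
  obtain ⟨φB, hφB⟩ := exists_ringHom_endAlgebra (A₀ := B) κ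
  have hAdim : finrank ℚ K = 2 * A.dim := hA.finrank_eq_two_mul_dim
  -- the type of `(A, φ_A)` is `Φ`
  have hΦA : cmTypeOfPair φA hAdim = Φ := cmTypeOfPair_eq_of_isCMTypeRealisation φA hAdim hA fun a => hφA a
  -- the type of `(B, φ_B)` is that of `(A, φ_A)`
  have hΦB : cmTypeOfPair φB hB = cmTypeOfPair φA hAdim :=
    cmTypeOfPair_eq_of_forall_charpoly_cotangentMap_eq φA hAdim φB hB (fun a => ι a) (fun a => κ a)
      (fun a => (hφA a).symm) (fun a => (hφB a).symm) h
  refine ⟨complexAction φB, ?_⟩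
  rw [← hΦA, ← hΦB]
  exact isCMTypeRealisation_cmTypeOfPair φB hB κ fun a => hφB a

end Realisation

end Literature.AlgebraicGeometry.ComplexMultiplication

end
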